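import Literature.NumberTheory.Sieve.HeathBrownCubicSieveSetupProofs
import HarnessLib

/-!
# Tools for Heath-Brown's Type I bound for `𝒜^(K)`: `S(R; X)`, Lemma 4.3, Lemma 4.2 over `K` (real form)

Companion of `HeathBrownCubicSieveSetup` in the decomposition of **parity.S18** along D. R. Heath-Brown,
*Primes represented by `x³ + 2y³`*, Acta Math. 186 (2001), 1–84. That file vendors the Type I bound
**Lemma 3.2** (level of distribution `X^{2−ε}` for `𝒜^(K)`) as the named fact
`HeathBrown2001_typeI_A`; Lemma 3.2 is deduced in §5 (pp. 30–32) from Lemma 5.1 (the same estimate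
for the count `S(R; X) = #{x, y ∈ (X, X(1+η)] : R ∣ x + y·2^{1/3}}` without the coprimality
condition), Lemma 4.7 (divisor sums of `τ(m + n·2^{1/3})^A` over boxes), Lemma 4.2 (moments of the
divisor function over the ideals of `K`) and Lemma 4.3 (`τ(IJ) ≤ τ(I)τ(J)`), by Möbius inversion
((5.3)), the singular series (5.4) and the tail estimates (5.5)–(5.6). This file supplies the
elementary layer of that deduction. Everything here is PROVED:

* `latticeBox`, `latticeCount` — the box of ALL pairs `x, y ∈ (X, X(1+η)]` and the count
  **`S(R; X)`** of p. 28 (`boxPairs`/`countA` of `HeathBrownCubicSieveSetup` are the coprime pairs: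
  `boxPairs_eq_filter_latticeBox`, `countA_le_latticeCount`);
* **Lemma 4.3** `idealDivisorCount_mul_le`: `τ(IJ) ≤ τ(I)τ(J)` (and `τ(D) ≤ τ(R)` for `D ∣ R`);
* **Lemma 4.2 over `K`** for a real bound: `∑_{0 < N(I) ≤ x} τ(I)^A ≤ C_A x (log x)^{2^{4A+4}}`,
  `x ≥ 2` (`exists_sum_idealDivisorCount_pow_le_real`, from the tree's integer-bound version
  `exists_sum_idealDivisorCount_pow_le` of `HeathBrownCubicSieveSetupProofs`, where Lemma 4.2 over `K`
  is proved from the moments of `τ` over `ℤ` via `c_K(n) ≤ τ(n)³`, `τ(I) ≤ τ(N(I))⁴`); also in the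
  shape `∃ c C ≥ 0, … ≤ C x (log x)^c` (`exists_sum_idealDivisorCount_rpow_le`).

Deliberately NOT here: the short-interval half of Lemma 4.2, Lemmas 4.4–4.7 and Lemma 5.1 (the
deeper inputs of Lemma 3.2), which belong to the files proving them.

## References

* D. R. Heath-Brown, *Primes represented by `x³ + 2y³`*, Acta Math. 186 (2001), 1–84: Lemma 4.2,
  Lemma 4.3 (p. 22), Lemma 5.1 (p. 28), (5.3) (p. 30). [cite: HeathBrownActa2001, §§4–5]

## Mathlib / tree search

Mathlib: `exists_dvd_and_dvd_of_dvd_mul` (ideals of a Dedekind domain form a `DecompositionMonoid`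
via unique factorisation), `Ideal.absNorm_dvd_absNorm_of_le`, `Nat.floor_le`, `Real.log_le_log`; no
divisor-sum estimates over number fields (searched `absNorm.*divisors`, `card_divisors.*Ideal`).
Tree: `HeathBrownCubicSieveSetup` (`boxPairs`, `pairIdeal`, `APairs`, `countA`, `idealsLE`,
`idealDivisorCount`), `HeathBrownCubicSieveSetupProofs` (`exists_sum_idealDivisorCount_pow_le`,
`idealDivisorCount_le_sigma_zero_pow_four`, `idealNormCount_le_sigma_zero_pow_three`).
-/

noncomputable section

open NumberField Finset

namespace Literature.NumberTheory.Sieve.CubicSieve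

open LFunctions.CubeRootTwoField

/-! ### The count `S(R; X)` of §5 (p. 28) -/

/-- The box of ALL pairs of natural numbers `x, y ∈ (X, X(1+η)]` — no coprimality condition — the
range of the count `S(R; X)` of §5 (p. 28); `boxPairs X η` is its subset of coprime pairs
(`boxPairs_eq_filter_latticeBox`). The bounding square `[0, ⌊X(1+η)⌋₊]²` loses no such pair
(`mem_latticeBox_iff`). [cite: HeathBrownActa2001, §5 p. 28] -/
def latticeBox (X η : ℝ) : Finset (ℕ × ℕ) :=
  {xy ∈ Iic ⌊X * (1 + η)⌋₊ ×ˢ Iic ⌊X * (1 + η)⌋₊ |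
      X < xy.1 ∧ (xy.1 : ℝ) ≤ X * (1 + η) ∧ X < xy.2 ∧ (xy.2 : ℝ) ≤ X * (1 + η)}

/-- Membership in `latticeBox`: the bounding square is redundant. [cite: HeathBrownActa2001, §5 p. 28] -/
theorem mem_latticeBox_iff {X η : ℝ} {xy : ℕ × ℕ} :
    xy ∈ latticeBox X η ↔
      X < xy.1 ∧ (xy.1 : ℝ) ≤ X * (1 + η) ∧ X < xy.2 ∧ (xy.2 : ℝ) ≤ X * (1 + η) := by
  simp only [latticeBox, mem_filter, mem_product, mem_Iic, and_iff_right_iff_imp]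
  rintro ⟨-, hx, -, hy⟩
  exact ⟨Nat.le_floor hx, Nat.le_floor hy⟩

/-- For `X ≥ 0` the box is the product of two copies of the integer interval
`(⌊X⌋₊, ⌊X(1+η)⌋₊]` (for a natural number `x`, `X < x ↔ ⌊X⌋₊ < x` and `x ≤ X(1+η) ↔ x ≤ ⌊X(1+η)⌋₊`).
[folklore] -/
theorem latticeBox_eq_product {X : ℝ} (hX : 0 ≤ X) (η : ℝ) :
    latticeBox X η = Ioc ⌊X⌋₊ ⌊X * (1 + η)⌋₊ ×ˢ Ioc ⌊X⌋₊ ⌊X * (1 + η)⌋₊ := by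
  ext ⟨x, y⟩
  simp only [mem_latticeBox_iff, mem_product, mem_Ioc, Nat.floor_lt hX]
  constructor
  · rintro ⟨hx1, hx2, hy1, hy2⟩
    exact ⟨⟨hx1, Nat.le_floor hx2⟩, hy1, Nat.le_floor hy2⟩
  · rintro ⟨⟨hx1, hx2⟩, hy1, hy2⟩
    have h0 : 0 ≤ X * (1 + η) := by
      by_contra h
      rw [not_le] at h
      rw [Nat.floor_of_nonpos h.le, Nat.le_zero] at hx2
      rw [hx2, Nat.cast_zero] at hx1
      exact absurd hx1 (not_lt.mpr hX)
    exact ⟨hx1, (Nat.le_floor_iff h0).mp hx2, hy1, (Nat.le_floor_iff h0).mp hy2⟩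

/-- `#box = (⌊X(1+η)⌋₊ − ⌊X⌋₊)²` for `X ≥ 0` (natural-number subtraction: the count of integers in
`(⌊X⌋₊, ⌊X(1+η)⌋₊]`, which is `0` if `η < 0`). [folklore] -/
theorem card_latticeBox {X : ℝ} (hX : 0 ≤ X) (η : ℝ) :
    #(latticeBox X η) = (⌊X * (1 + η)⌋₊ - ⌊X⌋₊) ^ 2 := by
  rw [latticeBox_eq_product hX, card_product, Nat.card_Ioc, sq]

/-- `𝒜^(K)` is indexed by the coprime pairs of the box: `boxPairs X η = {(x, y) ∈ latticeBox X η : (x, y) = 1}`.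
[cite: HeathBrownActa2001, §5 (5.3)] -/
theorem boxPairs_eq_filter_latticeBox (X η : ℝ) :
    boxPairs X η = {xy ∈ latticeBox X η | Nat.Coprime xy.1 xy.2} := by
  ext xy
  simp only [mem_boxPairs_iff, mem_filter, mem_latticeBox_iff, and_assoc]

open scoped Classical in
/-- **`S(R; X) = #{x, y ∈ (X, X(1+η)] : R ∣ x + y·2^{1/3}}`** (p. 28), the number of pairs of the
full box whose ideal `(x + y·2^{1/3})` is divisible by `R` — the quantity estimated by Lemma 5.1
(the paper suppresses `η` from the notation). [cite: HeathBrownActa2001, §5 p. 28] -/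
def latticeCount (X η : ℝ) (R : Ideal (𝓞 K)) : ℕ :=
  #{xy ∈ latticeBox X η | R ∣ pairIdeal xy}

open scoped Classical in
/-- `𝒜^(K)_R ⊆ {(x, y) ∈ box : R ∣ (x + y·2^{1/3})}`: the members of `𝒜^(K)_R` are the COPRIME pairs
counted by `S(R; X)`. [cite: HeathBrownActa2001, §5 (5.3)] -/
theorem APairs_eq_filter_latticeBox (X η : ℝ) (R : Ideal (𝓞 K)) :
    APairs X η R = {xy ∈ latticeBox X η | Nat.Coprime xy.1 xy.2 ∧ R ∣ pairIdeal xy} := by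
  classical
  rw [APairs, boxPairs_eq_filter_latticeBox, filter_filter]

open scoped Classical in
/-- `#𝒜^(K)_R ≤ S(R; X)` (dropping the coprimality condition). [cite: HeathBrownActa2001, §5 (5.3)] -/
theorem countA_le_latticeCount (X η : ℝ) (R : Ideal (𝓞 K)) : countA X η R ≤ latticeCount X η R := by
  classical
  rw [countA, APairs_eq_filter_latticeBox, latticeCount]
  exact card_le_card (monotone_filter_right _ fun xy _ h => h.2)

open scoped Classical in
/-- `S(R; X) ≤ #box ≤ (⌊X(1+η)⌋₊ + 1)²` (the trivial bound). [folklore] -/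
theorem latticeCount_le_sq (X η : ℝ) (R : Ideal (𝓞 K)) :
    latticeCount X η R ≤ (⌊X * (1 + η)⌋₊ + 1) ^ 2 := by
  classical
  rw [latticeCount]
  calc #{xy ∈ latticeBox X η | R ∣ pairIdeal xy} ≤ #(latticeBox X η) := card_filter_le _ _
    _ ≤ #(Iic ⌊X * (1 + η)⌋₊ ×ˢ Iic ⌊X * (1 + η)⌋₊) := card_filter_le _ _
    _ = (⌊X * (1 + η)⌋₊ + 1) ^ 2 := by rw [card_product, Nat.card_Iic, sq]

/-! ### Lemma 4.3: `τ(IJ) ≤ τ(I)τ(J)` -/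

open scoped Classical in
/-- Membership in the set of divisors counted by `τ(R)` (`idealDivisorCount`), `R ≠ 0`: exactly the
ideals `D ∣ R` (a divisor has norm dividing, hence at most, `N(R)`). [folklore] -/
theorem mem_filter_dvd_idealsLE_iff {R D : Ideal (𝓞 K)} (hR : R ≠ ⊥) :
    D ∈ (idealsLE (Ideal.absNorm R)).filter (· ∣ R) ↔ D ∣ R := by
  simp only [mem_filter, mem_idealsLE, and_iff_right_iff_imp]
  intro hDR
  exact Nat.le_of_dvd (Nat.pos_of_ne_zero fun h0 => hR (Ideal.absNorm_eq_zero_iff.mp h0))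
    (Ideal.absNorm_dvd_absNorm_of_le (Ideal.le_of_dvd hDR))

open scoped Classical in
/-- **Heath-Brown's Lemma 4.3**: "`τ(IJ) ≤ τ(I)τ(J)` for any two non-zero integral ideals" (p. 22;
there via multiplicativity and `τ(P^{e+f}) = e+f+1 ≤ (e+1)(f+1)`; here: every divisor of `IJ` is a
product `D₁D₂` with `D₁ ∣ I`, `D₂ ∣ J`, unique factorisation of ideals making `Ideal (𝓞 K)` a
decomposition monoid). [cite: HeathBrownActa2001, Lemma 4.3] -/
theorem idealDivisorCount_mul_le {I J : Ideal (𝓞 K)} (hI : I ≠ ⊥) (hJ : J ≠ ⊥) :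
    idealDivisorCount (I * J) ≤ idealDivisorCount I * idealDivisorCount J := by
  have hIJ : I * J ≠ ⊥ := mul_ne_zero hI hJ
  unfold idealDivisorCount
  calc #((idealsLE (Ideal.absNorm (I * J))).filter (· ∣ I * J))
      ≤ #((((idealsLE (Ideal.absNorm I)).filter (· ∣ I)) ×ˢ
            ((idealsLE (Ideal.absNorm J)).filter (· ∣ J))).image fun DE => DE.1 * DE.2) := by
        refine card_le_card fun D hD => ?_
        rw [mem_filter_dvd_idealsLE_iff hIJ] at hD
        obtain ⟨D₁, D₂, h₁, h₂, rfl⟩ := exists_dvd_and_dvd_of_dvd_mul hD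
        exact mem_image.mpr ⟨(D₁, D₂), mem_product.mpr
          ⟨(mem_filter_dvd_idealsLE_iff hI).mpr h₁, (mem_filter_dvd_idealsLE_iff hJ).mpr h₂⟩, rfl⟩
    _ ≤ #(((idealsLE (Ideal.absNorm I)).filter (· ∣ I)) ×ˢ ((idealsLE (Ideal.absNorm J)).filter (· ∣ J))) :=
        card_image_le
    _ = _ := card_product _ _

open scoped Classical in
/-- `τ(D) ≤ τ(R)` for `D ∣ R ≠ 0` (divisors of `D` are divisors of `R`). [folklore] -/
theorem idealDivisorCount_le_of_dvd {D R : Ideal (𝓞 K)} (hR : R ≠ ⊥) (hDR : D ∣ R) :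
    idealDivisorCount D ≤ idealDivisorCount R := by
  classical
  have hD : D ≠ ⊥ := by rintro rfl; exact hR (zero_dvd_iff.mp hDR)
  unfold idealDivisorCount
  refine card_le_card fun E hE => ?_
  rw [mem_filter_dvd_idealsLE_iff hD] at hE
  exact (mem_filter_dvd_idealsLE_iff hR).mpr (hE.trans hDR)

open scoped Classical in
/-- `1 ≤ τ(R)` for `R ≠ 0` (`R ∣ R`). [folklore] -/
theorem one_le_idealDivisorCount {R : Ideal (𝓞 K)} (hR : R ≠ ⊥) : 1 ≤ idealDivisorCount R := by
  classical
  unfold idealDivisorCount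
  exact card_pos.mpr ⟨R, (mem_filter_dvd_idealsLE_iff hR).mpr dvd_rfl⟩

/-! ### Lemma 4.2 over `K` for a real bound `x` -/

open scoped Classical in
/-- **Heath-Brown's Lemma 4.2 over `K`** (p. 22: "`∑_{N(I)≤x} τ(I)^A ≪ x (log x)^{c(A)}`") for a REAL
bound `x ≥ 2`, with `c(A) = 2^{4A+4}`: the tree's `exists_sum_idealDivisorCount_pow_le`
(`HeathBrownCubicSieveSetupProofs`, integer bound `N`) at `N = ⌊x⌋₊`, using `⌊x⌋₊ ≤ x` and
`log ⌊x⌋₊ ≤ log x`. [cite: HeathBrownActa2001, Lemma 4.2] -/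
theorem exists_sum_idealDivisorCount_pow_le_real (A : ℕ) :
    ∃ C : ℝ, 0 < C ∧ ∀ x : ℝ, 2 ≤ x →
      ∑ I ∈ (idealsLE ⌊x⌋₊).filter (· ≠ ⊥), (idealDivisorCount I : ℝ) ^ A ≤
        C * x * Real.log x ^ (2 ^ (4 * A + 4)) := by
  obtain ⟨C, hC, h⟩ := exists_sum_idealDivisorCount_pow_le A
  refine ⟨C, hC, fun x hx => ?_⟩
  have hX : 2 ≤ ⌊x⌋₊ := Nat.le_floor (by exact_mod_cast hx)
  have hx0 : 0 < x := by linarith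
  have hXx : (⌊x⌋₊ : ℝ) ≤ x := Nat.floor_le hx0.le
  have hX2 : (2 : ℝ) ≤ ⌊x⌋₊ := by exact_mod_cast hX
  have hlog : Real.log ⌊x⌋₊ ≤ Real.log x := Real.log_le_log (by linarith) hXx
  have hlog0 : 0 ≤ Real.log ⌊x⌋₊ := Real.log_nonneg (by linarith)
  calc ∑ I ∈ (idealsLE ⌊x⌋₊).filter (· ≠ ⊥), (idealDivisorCount I : ℝ) ^ A
      ≤ C * ⌊x⌋₊ * Real.log ⌊x⌋₊ ^ (2 ^ (4 * A + 4)) := h ⌊x⌋₊ hX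
    _ ≤ C * x * Real.log x ^ (2 ^ (4 * A + 4)) := by gcongr

open scoped Classical in
/-- Lemma 4.2 over `K` in the shape `∃ c, C ≥ 0, ∑_{0<N(I)≤x} τ(I)^A ≤ C x (log x)^c` (real bound, real
exponent), the form consumed by the deduction of Lemma 3.2. [cite: HeathBrownActa2001, Lemma 4.2] -/
theorem exists_sum_idealDivisorCount_rpow_le (A : ℕ) :
    ∃ c C : ℝ, 0 ≤ c ∧ 0 ≤ C ∧ ∀ x : ℝ, 2 ≤ x →
      ∑ I ∈ (idealsLE ⌊x⌋₊).filter (· ≠ ⊥), (idealDivisorCount I : ℝ) ^ A ≤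
        C * x * Real.log x ^ c := by
  obtain ⟨C, hC, h⟩ := exists_sum_idealDivisorCount_pow_le_real A
  refine ⟨(2 ^ (4 * A + 4) : ℕ), C, by positivity, hC.le, fun x hx => ?_⟩
  rw [Real.rpow_natCast]
  exact h x hx

end Literature.NumberTheory.Sieve.CubicSieve

end
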